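import Mathlib
import Literature.NumberTheory.LFunctions.ZetaSpacingDensityRH

/-!
# GapsEvoDoors — the sinc⁴ witness for `DeltaCIFinite`: Definitions

Cell rh-gaps (D-0143/D-0145), engine EVO-TF-1 (eng-1 g2): the door-(a) SEARCH OBJECT of route
`GapsEvoDoors` (item stmt-RiemannHypothesis-22421 `DeltaCIFinite`) settled in the kernel by ONE
elementary test function of the engine's band-limited genus (BL: `r = (λ² − u²)·h²`, `ĥ` =
triangle), found by exact evaluation of the cell functional (work/numerics/bl_triangle_cert.py;
cf. the certified witnesses of record (3/2, 1/20, 0.48381) eng-2 PW-SOS / (7/5, 1/20, 0.4999)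
eng-1 HG, referee V-11/V-12/V-13, and the Fejér triangle (8, 1/20, 0.499), V-16 — none of which is
needed here). Window Δ = 2 (the fragment «F → 1 on 1 < |α| ≤ 2»), ε = 1/100, λ = 49/100; this
one-function family has λ*(Δ = 2) = √(15/(7π²)) = 0.46597 (float; engines' class optimum at Δ = 2
is 0.375). A pure real-analysis ∃-statement: no RH, no zeta; computed ≠ proved applies to every
engine number quoted, NOT to the theorems below; nothing here bears on the truth of RH.

Data only (no proofs): `λ = 49/100`, `μ = 1/(4π²λ²)`, the witness
`r(u) = (1 − u²/λ²)·sinc(πu)⁴`, the closed form of its cosine transform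
`r̂(α) = σ(|α|) + μ σ″(|α|)` (`σ = T ∗ T` the cubic B-spline of the unit triangle `T`, so
`supp r̂ = [−2, 2]`), its polynomial pieces on `[0,1]` / `[1,2]`, and the antiderivatives used to
evaluate `∫ r̂(α) cos(wα) dα`, `∫ r̂`, `∫ α r̂(α) dα` in closed form. Proof files:
`GapsEvoDoorsSincWitness` (admissibility clauses), `GapsEvoDoorsSincTransform` (the Fourier pair
`r̂ = witnessHat` by explicit integration + Fourier inversion), `GapsEvoDoorsDeltaCIFinite` (the
certificate `c(r; 2, 1/100) = 139/1200 − (101/100)μ > 0 ⟸ π > 3.14`, closing item 22421).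
-/

noncomputable section

open Real MeasureTheory Set Filter Topology
open scoped FourierTransform
open Literature.NumberTheory.LFunctions Literature.NumberTheory.LFunctions.BGMM2023

set_option linter.dupNamespace false  -- the mandated namespace repeats `RiemannHypothesis`

namespace Summit.RiemannHypothesis.RiemannHypothesis.Theorems.GapsEvoDoorsSinc

/-- The spacing level `λ = 49/100` of the witness. -/
def lam : ℝ := 49 / 100

/-- `μ = 1/(4π²λ²)`, the coefficient of the second-derivative part of `r̂`. -/
def mu : ℝ := 1 / (4 * π ^ 2 * lam ^ 2)

/-- The witness `r(u) = (1 − u²/λ²)·sinc(πu)⁴` (`sinc x = sin x / x`). -/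
def witness (u : ℝ) : ℝ := (1 - u ^ 2 / lam ^ 2) * Real.sinc (π * u) ^ 4

/-- Closed form of `r̂`: `σ(|α|) + μ σ″(|α|)` with `σ = T ∗ T` the cubic spline
`σ(x) = (2−|x|)₊³/6 − (2/3)(1−|x|)₊³`, `σ″(x) = (2−|x|)₊ − 4(1−|x|)₊`. -/
def witnessHat (a : ℝ) : ℝ :=
  max (2 - |a|) 0 ^ 3 / 6 - 2 / 3 * max (1 - |a|) 0 ^ 3 + mu * (max (2 - |a|) 0 - 4 * max (1 -
|a|) 0)

/-- `r̂` on `[0, 1]`. -/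
def pieceA (x : ℝ) : ℝ := (2 - x) ^ 3 / 6 - 2 / 3 * (1 - x) ^ 3 + mu * (3 * x - 2)

/-- `r̂` on `[1, 2]`. -/
def pieceB (x : ℝ) : ℝ := (2 - x) ^ 3 / 6 + mu * (2 - x)

/-- Antiderivative of `pieceA(x) cos(wx)` (`w ≠ 0`). -/
def antiA (w x : ℝ) : ℝ :=
  pieceA x * Real.sin (w * x) / w
    + (-(2 - x) ^ 2 / 2 + 2 * (1 - x) ^ 2 + 3 * mu) * Real.cos (w * x) / w ^ 2
    - (3 * x - 2) * Real.sin (w * x) / w ^ 3 - 3 * Real.cos (w * x) / w ^ 4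

/-- Antiderivative of `pieceB(x) cos(wx)` (`w ≠ 0`). -/
def antiB (w x : ℝ) : ℝ :=
  pieceB x * Real.sin (w * x) / w
    + (-(2 - x) ^ 2 / 2 - mu) * Real.cos (w * x) / w ^ 2
    - (2 - x) * Real.sin (w * x) / w ^ 3 + Real.cos (w * x) / w ^ 4

/-- Antiderivative of `pieceA` (the `u = 0` case). -/
def primA (x : ℝ) : ℝ := -(2 - x) ^ 4 / 24 + (1 - x) ^ 4 / 6 + mu * (3 * x ^ 2 / 2 - 2 * x)

/-- Antiderivative of `pieceB` (the `u = 0` case). -/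
def primB (x : ℝ) : ℝ := -(2 - x) ^ 4 / 24 - mu * (2 - x) ^ 2 / 2

/-- Antiderivative of `x · pieceA(x)`. -/
def primXA (x : ℝ) : ℝ := x ^ 2 / 3 - x ^ 4 / 4 + x ^ 5 / 10 + mu * (x ^ 3 - x ^ 2)

end Summit.RiemannHypothesis.RiemannHypothesis.Theorems.GapsEvoDoorsSinc

end
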